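import Literature.AnabelianGeometry.SemiGraphs.SemiGraph
import Mathlib.CategoryTheory.Endomorphism
import HarnessLib

/-!
# The ALL-SUBGROUPS form of "no fixed branch-pair system" forces joint faithfulness of the finite-level
# actions ([SemiAnbd] Thm 3.7 (iii) p. 41 / Thm 5.4 (i) p. 66 — shape of the cell's binder `hnobpN`)

Mochizuki, *Semi-graphs of anabelioids*, Publ. RIMS **42** (2006), proof of Thm 3.7 (iii), manuscript
p. 41 (a COMPACT subgroup `H` read in the finite levels `𝔾_i`) and Thm 5.4 (i) p. 66 (l. 50: "the proofs
are entirely parallel") [cite: MochizukiSemiAnbd2006, Thm 3.7 (iii) p.41].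

KERNEL WITNESS (seat abc-iut-w4-d029, finding F-d029g3-1 on the T54-B capstone inputs; compare
abc-iut-L3-t6's `FiniteLevelData.eq_one_of_levelAct_eq_one`, finding F-t6g3-1, for the identification
(I4′)): the binder `hnobpN` of abc-iut-w4-d053's `ArithLevelDataCpt.ofChartEdgeData` / `ofCosetTower` and
of abc-iut-w4-d059's (AI3) derivations (`not_three_fixed_of_ne_bot`, `hEinj_of_edgeData`, …) quantifies
over ALL subgroups `C` of the chart group: "a subgroup fixing a compatible finite-level branch-pair system
is trivial".  Applied to the joint kernel `C₀ := ⨅_{i ≥ j₀} ker (levelAct i)` — which fixes EVERY system —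
it yields `C₀ = ⊥` as soon as ONE compatible branch-pair system exists past `j₀`
(`iInf_ker_eq_bot_of_noFixedBranchPairSystem_all`): the all-subgroups form is producible only over towers
whose finite-level actions are JOINTLY FAITHFUL, which a tower over a Galois-countability witness need not
be (abc-iut-L3-t6, TemperedLevelActFaithful.lean).  The consumers apply the binder only at edge-like,
hence compact, subgroups, for which the compact form (abc-iut-L3-t11's
`noFixedBranchPairSystem_of_isTotallyEstranged_cpt`) suffices.  Pure statement about abstract level data;
no definition; nothing here bears on [IUTchIII] Cor. 3.12.
-/

namespace Literature.AnabelianGeometry.SemiGraphs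

open CategoryTheory

universe v u w

/-- **The all-subgroups "no fixed branch-pair system" hypothesis forces the finite-level actions to be
jointly faithful past any level carrying a compatible branch-pair system**: the joint kernel
`⨅_{i ≥ j₀} ker (levelAct i)` fixes every system over `j₀`, so the hypothesis makes it trivial.
[cite: MochizukiSemiAnbd2006, Thm 3.7 (iii) p.41] -/
theorem iInf_ker_eq_bot_of_noFixedBranchPairSystem_all {Γ : Type w} [Group Γ]
    {J : Type v} [Preorder J] (level : J → SemiGraph.{u}) (levelAct : ∀ j, Γ →* Aut (level j))
    (levelTrans : ∀ ⦃i j : J⦄, i ≤ j → (level j ⟶ level i))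
    (hnobp : ∀ (C : Subgroup Γ) (j₀ : J) (w : ∀ i : {i : J // j₀ ≤ i}, (level i.1).Vertex)
      (β β' : ∀ i : {i : J // j₀ ≤ i}, (level i.1).Branch),
      (∀ i, β i ≠ β' i ∧ (level i.1).abuts (β i) = some (w i) ∧ (level i.1).abuts (β' i) = some (w i)) →
      (∀ ⦃i i' : {i : J // j₀ ≤ i}⦄ (h : i.1 ≤ i'.1), (levelTrans h).vertexMap (w i') = w i ∧
        (levelTrans h).branchMap (β i') = β i ∧ (levelTrans h).branchMap (β' i') = β' i) →
      (∀ (i : {i : J // j₀ ≤ i}) (γ : C), (levelAct i.1 γ).hom.vertexMap (w i) = w i ∧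
        (levelAct i.1 γ).hom.branchMap (β i) = β i ∧ (levelAct i.1 γ).hom.branchMap (β' i) = β' i) →
      C = ⊥)
    (j₀ : J) (w : ∀ i : {i : J // j₀ ≤ i}, (level i.1).Vertex)
    (β β' : ∀ i : {i : J // j₀ ≤ i}, (level i.1).Branch)
    (hpair : ∀ i, β i ≠ β' i ∧ (level i.1).abuts (β i) = some (w i) ∧
      (level i.1).abuts (β' i) = some (w i))
    (hcompat : ∀ ⦃i i' : {i : J // j₀ ≤ i}⦄ (h : i.1 ≤ i'.1), (levelTrans h).vertexMap (w i') = w i ∧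
      (levelTrans h).branchMap (β i') = β i ∧ (levelTrans h).branchMap (β' i') = β' i) :
    (⨅ i : {i : J // j₀ ≤ i}, (levelAct i.1).ker) = ⊥ := by
  refine hnobp _ j₀ w β β' hpair hcompat fun i γ => ?_
  have hγ : levelAct i.1 (γ : Γ) = 1 :=
    (MonoidHom.mem_ker).mp (Subgroup.mem_iInf.mp γ.2 i)
  have h1 : (levelAct i.1 (γ : Γ)).hom = 𝟙 (level i.1) := by rw [hγ]; rfl
  simp only [h1, SemiGraph.id_vertexMap, SemiGraph.id_branchMap, id_eq, and_self]

/-- **Element form**: under the all-subgroups hypothesis, an element acting trivially on every finite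
level past `j₀` (where a compatible branch-pair system lives) is trivial. [cite: MochizukiSemiAnbd2006, Thm 3.7 (iii) p.41] -/
theorem eq_one_of_forall_levelAct_eq_one_of_noFixedBranchPairSystem_all {Γ : Type w} [Group Γ]
    {J : Type v} [Preorder J] (level : J → SemiGraph.{u}) (levelAct : ∀ j, Γ →* Aut (level j))
    (levelTrans : ∀ ⦃i j : J⦄, i ≤ j → (level j ⟶ level i))
    (hnobp : ∀ (C : Subgroup Γ) (j₀ : J) (w : ∀ i : {i : J // j₀ ≤ i}, (level i.1).Vertex)
      (β β' : ∀ i : {i : J // j₀ ≤ i}, (level i.1).Branch),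
      (∀ i, β i ≠ β' i ∧ (level i.1).abuts (β i) = some (w i) ∧ (level i.1).abuts (β' i) = some (w i)) →
      (∀ ⦃i i' : {i : J // j₀ ≤ i}⦄ (h : i.1 ≤ i'.1), (levelTrans h).vertexMap (w i') = w i ∧
        (levelTrans h).branchMap (β i') = β i ∧ (levelTrans h).branchMap (β' i') = β' i) →
      (∀ (i : {i : J // j₀ ≤ i}) (γ : C), (levelAct i.1 γ).hom.vertexMap (w i) = w i ∧
        (levelAct i.1 γ).hom.branchMap (β i) = β i ∧ (levelAct i.1 γ).hom.branchMap (β' i) = β' i) →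
      C = ⊥)
    (j₀ : J) (w : ∀ i : {i : J // j₀ ≤ i}, (level i.1).Vertex)
    (β β' : ∀ i : {i : J // j₀ ≤ i}, (level i.1).Branch)
    (hpair : ∀ i, β i ≠ β' i ∧ (level i.1).abuts (β i) = some (w i) ∧
      (level i.1).abuts (β' i) = some (w i))
    (hcompat : ∀ ⦃i i' : {i : J // j₀ ≤ i}⦄ (h : i.1 ≤ i'.1), (levelTrans h).vertexMap (w i') = w i ∧
      (levelTrans h).branchMap (β i') = β i ∧ (levelTrans h).branchMap (β' i') = β' i)
    (g : Γ) (htriv : ∀ i : J, j₀ ≤ i → levelAct i g = 1) : g = 1 := by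
  have hmem : g ∈ (⨅ i : {i : J // j₀ ≤ i}, (levelAct i.1).ker) :=
    Subgroup.mem_iInf.mpr fun i => (MonoidHom.mem_ker).mpr (htriv i.1 i.2)
  rw [iInf_ker_eq_bot_of_noFixedBranchPairSystem_all level levelAct levelTrans hnobp j₀ w β β' hpair
    hcompat] at hmem
  exact (Subgroup.mem_bot).mp hmem

end Literature.AnabelianGeometry.SemiGraphs
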